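import Summits.PneNP.PneNP.Theorems.ExpanderLinearGeneratorsNoPolyBoundedProofSystem
import Literature.Barriers.PneNP.Relativization
import Literature.Barriers.PneNP.RelativizedCircuitSizeProofs
import Literature.Computability.Complexity.Algebrization
import Literature.Computability.Complexity.AlgebrizationCollapse
import Literature.Computability.Complexity.BakerGillSolovayRecursive
import Literature.Computability.Complexity.PRelHierarchy
import Literature.Computability.Complexity.OracleEmpty

/-!
# Route ExpanderLinearGenerators — barrier certificate for the target `NoPolyBoundedProofSystem`

Helper file for item `stmt-PneNP-0097` (the rank-0 target
`Summit.PneNP.PneNP.Theses.ExpanderLinearGenerators.NoPolyBoundedProofSystem :=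
 ¬ HasPolyBoundedProofSystem TAUT`, shared verbatim by the routes ProofCplx, AperiodicTorus,
LyapunovRefutations, MatroidTseitin, BruckRyserSos). The companion file
`ExpanderLinearGeneratorsNoPolyBoundedProofSystem.lean` shows, kernel-checked, that the target is
`NP ≠ coNP` over the tree's classes. This file records — again kernel-checked, every input being a
theorem of the tree and no named fact left as a hypothesis — the two catalogued technique barriers
(D-0021) that every proof of the target must evade, in the vocabulary of
`Literature/Barriers/PneNP/Relativization.lean` (`Relativizes`) and of Aaronson–Wigderson
(`IsAlgebrizingSeparation`, `Literature/Computability/Complexity/Algebrization.lean`):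

* **Oracle family and anchor.** The target is the empty-oracle instance of the oracle family
  `O ↦ NP^O ≠ coNP^O`: `NPRel ∅ = NP` (tree theorem `NPRel_empty`, from `PRel_empty_holds :
  P^∅ = P`) and `coNPRel ∅ = coNP`, hence `NoPolyBoundedProofSystem ↔ NPRel ∅ ≠ coNPRel ∅`
  (`noPolyBoundedProofSystem_iff_NPRel_empty_ne_coNPRel_empty`).
* **Relativization (Baker–Gill–Solovay 1975).** `P^O` is closed under complement
  (`compl_mem_PRel`), so `P^A = NP^A` forces `NP^A = coNP^A`; with the tree's recursive BGS oracle
  (`BGS.exists_computable_oracle_PRel_eq_NPRel`, Thm. 1 of BGS) this gives a recursive `A` with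
  `NP^A = coNP^A`, so `O ↦ NP^O ≠ coNP^O` does NOT relativize (`not_relativizes_NPRel_ne_coNPRel`):
  no relativizing argument proves the target. Conversely Wilson's oracle `C` with `NP^C ≠ coNP^C`
  (tree theorem `Literature.Barriers.PneNP.not_relativizes_NP_eq_coNP`, Wilson 1985 Thm. 4) shows
  that the negation does not relativize either (`noPolyBoundedProofSystem_shape_not_relativizes`).
* **Algebrization (Aaronson–Wigderson 2009, Thm. 5.1).** From the tree theorem
  `aaronson_wigderson_collapse_holds` (`∃ A Ã, NP^Ã ⊆ P^A`) and the same complement closure: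
  `coNP^Ã ⊆ NP^A` and `NP^Ã ⊆ coNP^A`, so neither separation shape of the target, `coNP ⊄ NP` or
  `NP ⊄ coNP`, is an algebrizing separation (`not_isAlgebrizingSeparation_coNPRel_NPRel`,
  `not_isAlgebrizingSeparation_NPRel_coNPRel`): no algebrizing argument proves the target.

What is NOT here: the converse algebrization statement (`coNP ⊆ NP` is not an algebrizing
inclusion, AW Thm. 5.3-type worlds with `coNP^A ⊄ NP^Ã`), whose oracle is not constructed in the
tree; natural proofs (the target is not a circuit lower bound); any claim about the target itself,
which remains the open problem `NP ≠ coNP` (Krajíček 2019, Problem 1.5.3).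

Sources: T. Baker, J. Gill, R. Solovay, SIAM J. Comput. 4 (1975) 431–442, Thm. 1 and §3;
S. Arora, B. Barak, *Computational Complexity* (2009), §3.4, Thm. 3.7; C. B. Wilson, *Relativized
circuit complexity*, JCSS 31 (1985), Thm. 4; S. Aaronson, A. Wigderson, *Algebrization: a new
barrier in complexity theory*, TOCT 1 (2009), Def. 1.2 and Thm. 5.1; S. A. Cook, R. A. Reckhow,
JSL 44 (1979), Prop. 1.1.
-/

set_option linter.dupNamespace false -- `Summit.PneNP.PneNP.…`: summit = sub-problem name (D-0017 single-conjunct layout)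

namespace Summit.PneNP.PneNP.Theorems

open Literature.Computability.Complexity Literature.Computability.MetaComplexity
open Literature.Barriers.PneNP
open Summit.PneNP.PneNP.Theses.ExpanderLinearGenerators

/-! ### Complement closure of `P^O` and its consequence for `NP^O` versus `coNP^O` -/

/-- If `P^O = NP^O` then `NP^O = coNP^O`: `coNP^O = co NP^O = co P^O = P^O = NP^O`, the middle
step being the complement closure of `P^O` (tree theorem `compl_mem_PRel`, flip the output bit;
as a class identity `co P^O = P^O` this is `Literature.Barriers.QuantumAdvantage.co_PRel`). This is
why every oracle collapsing `P` and `NP` — in particular the Baker–Gill–Solovay oracle `A` — also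
collapses `NP` and `coNP`. [cite: BakerGillSolovay1975, §1 and Thm. 1] -/
theorem NPRel_eq_coNPRel_of_PRel_eq_NPRel {O : Oracle} (h : PRel O = NPRel O) :
    NPRel O = coNPRel O := by
  unfold coNPRel
  rw [← h]
  ext L
  refine ⟨fun hL => compl_mem_PRel hL, fun hL => ?_⟩
  have h' : Lᶜᶜ ∈ PRel O := compl_mem_PRel hL
  rwa [compl_compl] at h'

/-- **A world where the target fails** (Baker–Gill–Solovay 1975, Thm. 1, with the remark above):
there is a recursive oracle `A` with `NP^A = coNP^A` — the tree's Ko fixed-point oracle with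
`P^A = NP^A` (`BGS.exists_computable_oracle_PRel_eq_NPRel`). [cite: BakerGillSolovay1975, Thm. 1] -/
theorem exists_computable_oracle_NPRel_eq_coNPRel :
    ∃ A : Language Bool, ComputablePred (· ∈ A) ∧
      NPRel (Oracle.ofLanguage A) = coNPRel (Oracle.ofLanguage A) := by
  obtain ⟨A, hA, hPNP⟩ := BGS.exists_computable_oracle_PRel_eq_NPRel
  exact ⟨A, hA, NPRel_eq_coNPRel_of_PRel_eq_NPRel hPNP⟩

/-! ### Relativization: the oracle family `O ↦ NP^O ≠ coNP^O` -/

/-- **`NP ≠ coNP` has no relativizing proof**: the oracle family `O ↦ NP^O ≠ coNP^O` fails at the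
Baker–Gill–Solovay oracle `A`, so it does not hold relative to every language oracle
(`Relativizes`, `Literature/Barriers/PneNP/Relativization.lean`).
[cite: BakerGillSolovay1975, Thm. 1] -/
theorem not_relativizes_NPRel_ne_coNPRel : ¬ Relativizes fun O => NPRel O ≠ coNPRel O := by
  obtain ⟨A, -, hA⟩ := exists_computable_oracle_NPRel_eq_coNPRel
  exact fun hrel => hrel A hA

/-- The same no-go for ANY oracle-indexed statement that would yield `NP^A ≠ coNP^A` at every
language oracle `A` (e.g. a relativizing superpolynomial lower bound for all proof systems for
`TAUT^A`): such a statement fails at the Baker–Gill–Solovay oracle. [cite: BakerGillSolovay1975, Thm. 1] -/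
theorem not_relativizes_of_forall_NPRel_ne_coNPRel {Φ : Oracle → Prop}
    (hΦ : ∀ A : Language Bool, Φ (Oracle.ofLanguage A) →
      NPRel (Oracle.ofLanguage A) ≠ coNPRel (Oracle.ofLanguage A)) :
    ¬ Relativizes Φ := by
  obtain ⟨A, -, hA⟩ := exists_computable_oracle_NPRel_eq_coNPRel
  exact fun hrel => hΦ A (hrel A) hA

/-- The two separation shapes do not relativize either: neither `O ↦ coNP^O ⊄ NP^O` nor
`O ↦ NP^O ⊄ coNP^O` holds at the Baker–Gill–Solovay oracle. [cite: BakerGillSolovay1975, Thm. 1] -/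
theorem not_relativizes_coNPRel_not_subset_NPRel :
    (¬ Relativizes fun O => ¬ coNPRel O ⊆ NPRel O) ∧ ¬ Relativizes fun O => ¬ NPRel O ⊆ coNPRel O := by
  obtain ⟨A, -, hA⟩ := exists_computable_oracle_NPRel_eq_coNPRel
  exact ⟨fun hrel => hrel A (hA ▸ subset_rfl), fun hrel => hrel A (hA ▸ subset_rfl)⟩

/-- **Contrary worlds**: a recursive `A` with `NP^A = coNP^A` (Baker–Gill–Solovay) and Wilson's `C`
with `NP^C ≠ coNP^C` (tree theorem `Wilson1985_thm_4_holds`). [cite: Wilson1985, Thm. 4] -/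
theorem exists_contrary_oracles_NPRel_coNPRel :
    (∃ A : Language Bool, NPRel (Oracle.ofLanguage A) = coNPRel (Oracle.ofLanguage A)) ∧
      ∃ C : Language Bool, NPRel (Oracle.ofLanguage C) ≠ coNPRel (Oracle.ofLanguage C) := by
  obtain ⟨A, -, hA⟩ := exists_computable_oracle_NPRel_eq_coNPRel
  obtain ⟨C, hC, -⟩ := Wilson1985_thm_4_holds
  exact ⟨⟨A, hA⟩, C, hC⟩

/-! ### Anchor: the empty-oracle instance of the family is the route target -/

/-- `coNP^∅ = coNP` (`coNP^O = co NP^O`, `coNP = co NP`, and the tree theorem `NPRel_empty :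
NP^∅ = NP`, itself from `PRel_empty_holds : P^∅ = P`). [cite: BakerGillSolovay1975, §1] -/
theorem coNPRel_empty : coNPRel Oracle.empty = coNP := by
  unfold coNPRel coNP
  rw [NPRel_empty]

/-- **Anchor.** The route target is the empty-oracle instance of `O ↦ NP^O ≠ coNP^O`: by
Cook–Reckhow (tree: `noPolyBoundedProofSystem_iff_NP_ne_coNP`) it is `NP ≠ coNP`, and `NP^∅ = NP`,
`coNP^∅ = coNP`. [cite: CookReckhow1979, §1 Prop. 1.1] -/
theorem noPolyBoundedProofSystem_iff_NPRel_empty_ne_coNPRel_empty :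
    NoPolyBoundedProofSystem ↔ NPRel Oracle.empty ≠ coNPRel Oracle.empty := by
  rw [noPolyBoundedProofSystem_iff_NP_ne_coNP, NPRel_empty, coNPRel_empty]

/-- **Relativization barrier certificate for the target** (D-0021 reading of
`Literature.Barriers.PneNP.Relativization` at `NP` versus `coNP`): the oracle family whose
`∅`-instance is `NoPolyBoundedProofSystem` relativizes in NEITHER direction — `O ↦ NP^O ≠ coNP^O`
fails at the Baker–Gill–Solovay oracle, `O ↦ NP^O = coNP^O` fails at Wilson's oracle (tree theorem
`not_relativizes_NP_eq_coNP`). So neither the target nor its negation has a relativizing proof.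
[cite: AroraBarakCC2009, Thm. 3.7 and §3.4 p. 74] -/
theorem noPolyBoundedProofSystem_shape_not_relativizes :
    (NoPolyBoundedProofSystem ↔ NPRel Oracle.empty ≠ coNPRel Oracle.empty) ∧
      (¬ Relativizes fun O => NPRel O ≠ coNPRel O) ∧ ¬ Relativizes fun O => NPRel O = coNPRel O :=
  ⟨noPolyBoundedProofSystem_iff_NPRel_empty_ne_coNPRel_empty, not_relativizes_NPRel_ne_coNPRel,
    not_relativizes_NP_eq_coNP⟩

/-! ### Algebrization: the separation shapes of the target do not algebrize -/

/-- In an Aaronson–Wigderson collapsing world `NP^Ã ⊆ P^A` one has `coNP^Ã ⊆ NP^A`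
(`coNP^Ã = co NP^Ã ⊆ co P^A = P^A ⊆ NP^A`). [cite: AaronsonWigderson2009, Thm. 5.1] -/
theorem coNPRel_subset_NPRel_of_NPRel_subset_PRel {O O' : Oracle} (h : NPRel O ⊆ PRel O') :
    coNPRel O ⊆ NPRel O' := by
  intro L hL
  have h1 : Lᶜ ∈ PRel O' := h hL
  have h2 : L ∈ PRel O' := by simpa only [compl_compl] using compl_mem_PRel h1
  exact PRel_subset_NPRel_holds O' h2

/-- In an Aaronson–Wigderson collapsing world `NP^Ã ⊆ P^A` one has `NP^Ã ⊆ coNP^A`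
(`P^A ⊆ coNP^A` by complement closure). [cite: AaronsonWigderson2009, Thm. 5.1] -/
theorem NPRel_subset_coNPRel_of_NPRel_subset_PRel {O O' : Oracle} (h : NPRel O ⊆ PRel O') :
    NPRel O ⊆ coNPRel O' := by
  intro L hL
  have h1 : Lᶜ ∈ PRel O' := compl_mem_PRel (h hL)
  exact PRel_subset_NPRel_holds O' h1

/-- **`coNP ⊄ NP` is not an algebrizing separation** (Aaronson–Wigderson, Def. 1.2 (2)): the tree's
collapsing pair `(A, Ã)` with `NP^Ã ⊆ P^A` (`aaronson_wigderson_collapse_holds`, AW Thm. 5.1) has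
`coNP^Ã ⊆ NP^A`. So no algebrizing argument proves the target in the shape `coNP ⊄ NP`.
[cite: AaronsonWigderson2009, Thm. 5.1 with Def. 1.2] -/
theorem not_isAlgebrizingSeparation_coNPRel_NPRel : ¬ IsAlgebrizingSeparation coNPRel NPRel := by
  obtain ⟨A, Ã, d, hext, hsub⟩ := aaronson_wigderson_collapse_holds
  exact fun h => h A Ã d hext (coNPRel_subset_NPRel_of_NPRel_subset_PRel hsub)

/-- **`NP ⊄ coNP` is not an algebrizing separation**: the same pair has `NP^Ã ⊆ coNP^A`.
[cite: AaronsonWigderson2009, Thm. 5.1 with Def. 1.2] -/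
theorem not_isAlgebrizingSeparation_NPRel_coNPRel : ¬ IsAlgebrizingSeparation NPRel coNPRel := by
  obtain ⟨A, Ã, d, hext, hsub⟩ := aaronson_wigderson_collapse_holds
  exact fun h => h A Ã d hext (NPRel_subset_coNPRel_of_NPRel_subset_PRel hsub)

/-- **Barrier summary for item `stmt-PneNP-0097`.** The target is `NP^∅ ≠ coNP^∅`; the family
`O ↦ NP^O ≠ coNP^O` does not relativize, its negation does not relativize, and neither separation
shape `coNP ⊄ NP`, `NP ⊄ coNP` algebrizes: a proof of the target must be simultaneously
non-relativizing and non-algebrizing. [cite: AaronsonWigderson2009, §1.2–1.3 and Thm. 5.1] -/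
theorem noPolyBoundedProofSystem_barriers :
    (NoPolyBoundedProofSystem ↔ NPRel Oracle.empty ≠ coNPRel Oracle.empty) ∧
      (¬ Relativizes fun O => NPRel O ≠ coNPRel O) ∧
      (¬ Relativizes fun O => NPRel O = coNPRel O) ∧
      ¬ IsAlgebrizingSeparation coNPRel NPRel ∧ ¬ IsAlgebrizingSeparation NPRel coNPRel :=
  ⟨noPolyBoundedProofSystem_iff_NPRel_empty_ne_coNPRel_empty, not_relativizes_NPRel_ne_coNPRel,
    not_relativizes_NP_eq_coNP, not_isAlgebrizingSeparation_coNPRel_NPRel,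
    not_isAlgebrizingSeparation_NPRel_coNPRel⟩

end Summit.PneNP.PneNP.Theorems
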